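import Literature.Analysis.FluidPDE.TaoForcedUniquenessApriori
import Literature.Analysis.FluidPDE.TaoForcedUniquenessSchwartzForce
import Literature.Analysis.FluidPDE.TaoForcedFiniteEnergyLerayHopfAE
import Literature.Analysis.FluidPDE.TaoForcedNormalisedPressureDischarge
import Literature.Analysis.FluidPDE.ForcePotentialL2Bound
import HarnessLib

/-!
# Tao (2011/2013), Cor. 11.4 WITH a Clay-class (Schwartz) force, reduced to the bounded total
# speed of the two solutions: Lemma 8.1 WITH force discharged for Fefferman's force class

Cell `pub/ns-blowup`, seat `ns-blowup-lean2` — PATH A of the E–C route's Literature leaf W14 =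
`Literature.Analysis.FluidPDE.tao2011_forced_unconditionalUniqueness_velocity`, in the Clay-class
specialisation the route consumes (`tao2011_forced_unconditionalUniqueness_velocity.schwartzForce`,
`TaoForcedUniquenessSchwartzForce.lean`). WHAT THIS IS NOT: not a statement about Navier–Stokes
blow-up — forced uniqueness bookkeeping; and not yet the discharge of W14: the residual hypothesis
is the finite total speed `∫₀ᵀ‖u‖_{L^∞} < ∞` of the two solutions (Tao 2011, Prop. 9.1 = arXiv
Prop. 52 WITH force, not yet in the tree).

`TaoForcedUniquenessApriori.lean` reduces Cor. 11.4 WITH force to finite dissipation (Lemma 8.1)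
and finite total speed (Prop. 9.1) of the two solutions. For a force in Fefferman's class (C) —
`IsSmoothOnHalfSpace f ∧ HasRapidSpaceTimeDecay f` — the dissipation half is a theorem: the tree's
forced energy equality `IsClassicalNSSolutionOn.energyEq_of_finiteEnergy_forced_ae_of_fact`
(`TaoForcedFiniteEnergyLerayHopfAE`, Tao §8 (61)–(65) WITH force) fed with the PROVED corrected
pressure normalisation `tao2011_forced_pressure_normalisation_ae_holds`
(`TaoForcedNormalisedPressureDischarge`) needs only uniform `L²` bounds of the slices `f(t)` and of
their force potentials `Δ⁻¹∇·f(t)` (`ForcePotentialL2Bound.eLpNorm_forcePotential_le`), which the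
decay (5) supplies:

* `clayForce_slice_sup_integrable`, `clayForce_slice_potential_bounds` — the uniform slice bounds;
* `IsClassicalNSSolutionOn.dissipation_lt_top_of_clayForce` — Lemma 8.1 WITH a Clay force:
  `∫₀ᵀ∫|∇u|² < ∞` for every finite energy classical solution;
* `tao2011_forced_unconditionalUniqueness_velocity_schwartzForce_of_totalSpeed` — Cor. 11.4 WITH a
  Clay force, velocity form, in the dictionary of `.schwartzForce`, GIVEN finite total speed of the
  two solutions.

Everything is proved; no definition and no named fact is introduced (D-0026).

## Mathlib / tree search

Tree: `HasRapidSpaceTimeDecay.hasUniformRapidDecayOn`, `HasUniformRapidDecayOn.norm_le_rpow`,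
`HasRapidSpaceTimeDecay.exists_lintegral_iteratedFDeriv_slice_sq_le`,
`lintegral_iteratedFDeriv_sq_lt_top_of_memLp` (`TaoForcedUniquenessSchwartzForce`,
`RapidDecayLemmas`), `eLpNorm_forcePotential_le`, `integrable_forceMajorant_near`,
`memLp_forceMajorant_far`, `aestronglyMeasurable_forcePotential` (`ForcePotentialL2Bound`).
Mathlib: `integrable_one_add_norm`, `finite_integral_one_add_norm`.

## References

* T. Tao, *Localisation and compactness properties of the Navier–Stokes global regularity
  problem*, Anal. PDE 6 (2013) 25–107 = arXiv:1108.1165 (`Tao2011`): Cor. 11.4 (arXiv Cor. 71,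
  p. 36), Lemma 8.1 (arXiv Lemma 44), Prop. 9.1 (arXiv Prop. 52), §1 p. 3 (Schwartz data), (9).
* C. Fefferman, Clay problem description (`FeffermanClay2006`), (5).
-/

noncomputable section

open MeasureTheory Set Function Filter Topology
open scoped ENNReal NNReal RealInnerProductSpace ContDiff

namespace Literature.Analysis.FluidPDE

/-! ## Fefferman's Clay class: the dissipation hypothesis discharged (Lemma 8.1 WITH force) -/

section ClayForce

variable {f : ℝ → EuclideanSpace ℝ (Fin 3) → EuclideanSpace ℝ (Fin 3)}

/-- `(∫⁻ ‖g‖ₑ²)^{1/2} = ‖g‖_{L²}` (plumbing). [folklore] -/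
private theorem eLpNorm_two_eq_sqrt_lintegral' {G : Type*} [NormedAddCommGroup G] {X : Type*}
    [MeasurableSpace X] {μ : Measure X} (g : X → G) :
    eLpNorm g 2 μ = (∫⁻ x, ‖g x‖ₑ ^ 2 ∂μ) ^ (1 / 2 : ℝ) := by
  rw [eLpNorm_eq_lintegral_rpow_enorm_toReal two_ne_zero ENNReal.ofNat_ne_top]
  have h2 : (2 : ℝ≥0∞).toReal = 2 := by norm_num
  rw [h2]
  simp only [ENNReal.rpow_two]

/-- **Uniform sup and `L¹` bounds of the slices of a Clay-class force** (Fefferman's (5): decay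
`(1 + |x|)⁻⁴`, `4 > 3`): there are `M : ℝ` and `N < ⊤` with `‖f t x‖ ≤ M`, `f t` integrable and
`∫⁻ ‖f t‖ₑ ≤ N` for all `0 ≤ t ≤ T`. [cite: FeffermanClay2006, (5)] -/
theorem clayForce_slice_sup_integrable {T : ℝ} (hfs : IsSmoothOnHalfSpace f)
    (hfd : HasRapidSpaceTimeDecay f) :
    ∃ (M : ℝ) (N : ℝ≥0∞), N < ⊤ ∧ ∀ t ∈ Icc 0 T,
      (∀ x, ‖f t x‖ ≤ M) ∧ Integrable (f t) ∧ ∫⁻ x, ‖f t x‖ₑ ≤ N := by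
  obtain ⟨C, hC0, hC⟩ := hfd.hasUniformRapidDecayOn.norm_le_rpow 4
  set J : ℝ≥0∞ := ∫⁻ x : EuclideanSpace ℝ (Fin 3), ENNReal.ofReal ((1 + ‖x‖) ^ (-((4 : ℕ) : ℝ)))
    with hJ
  have hJ' : J < ⊤ := finite_integral_one_add_norm (by rw [finrank_euclideanSpace_fin]; norm_num)
  have hJi : Integrable (fun x : EuclideanSpace ℝ (Fin 3) => (1 + ‖x‖) ^ (-((4 : ℕ) : ℝ))) volume :=
    integrable_one_add_norm (by rw [finrank_euclideanSpace_fin]; norm_num)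
  refine ⟨C, ENNReal.ofReal C * J, ENNReal.mul_lt_top ENNReal.ofReal_lt_top hJ', fun t ht => ?_⟩
  have hct : Continuous (f t) :=
    ((hfs.isSmoothSpaceTimeOn_Icc T).contDiff_slice ht).continuous
  have hpt : ∀ x, ‖f t x‖ ≤ C * (1 + ‖x‖) ^ (-((4 : ℕ) : ℝ)) := fun x => hC t (mem_Ici.2 ht.1) x
  have hsup : ∀ x, ‖f t x‖ ≤ C := fun x => by
    refine (hpt x).trans ?_
    have h1 : (1 + ‖x‖) ^ (-((4 : ℕ) : ℝ)) ≤ 1 :=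
      Real.rpow_le_one_of_one_le_of_nonpos (by linarith [norm_nonneg x]) (by norm_num)
    nlinarith
  have hint : Integrable (f t) :=
    (hJi.const_mul C).mono' hct.aestronglyMeasurable (Eventually.of_forall hpt)
  refine ⟨hsup, hint, ?_⟩
  rw [hJ, ← lintegral_const_mul' _ _ ENNReal.ofReal_ne_top]
  refine lintegral_mono fun x => ?_
  calc ‖f t x‖ₑ = ENNReal.ofReal ‖f t x‖ := (ofReal_norm _).symm
    _ ≤ ENNReal.ofReal (C * (1 + ‖x‖) ^ (-((4 : ℕ) : ℝ))) := ENNReal.ofReal_le_ofReal (hpt x)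
    _ = ENNReal.ofReal C * ENNReal.ofReal ((1 + ‖x‖) ^ (-((4 : ℕ) : ℝ))) := ENNReal.ofReal_mul hC0

/-- **Uniform `L²` bounds of the slices of a Clay-class force and of their force potentials**:
there are `C_f < ⊤` and `Π < ⊤` with `∫⁻ ‖f t‖ₑ² ≤ C_f`, `Δ⁻¹∇·f(t)` a.e. strongly measurable and
`∫⁻ ‖Δ⁻¹∇·f(t)‖ₑ² ≤ Π` for all `0 ≤ t ≤ T` (`eLpNorm_forcePotential_le`:
`‖Δ⁻¹∇·g‖₂ ≤ ‖κ₁‖₁‖g‖₂ + ‖g‖₁‖κ₂‖₂` with the uniform slice bounds). [cite: Tao2011, (9) p. 5 and §1 p. 3 (Schwartz data are H¹ data)] -/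
theorem clayForce_slice_potential_bounds {T : ℝ} (hfs : IsSmoothOnHalfSpace f)
    (hfd : HasRapidSpaceTimeDecay f) :
    ∃ (Cf Pf : ℝ≥0∞), Cf < ⊤ ∧ Pf < ⊤ ∧ ∀ t ∈ Icc 0 T,
      ∫⁻ x, ‖f t x‖ₑ ^ 2 ≤ Cf ∧ AEStronglyMeasurable (forcePotential (f t)) volume ∧
        ∫⁻ x, ‖forcePotential (f t) x‖ₑ ^ 2 ≤ Pf := by
  obtain ⟨M, N, hNt, hMN⟩ := clayForce_slice_sup_integrable (T := T) hfs hfd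
  obtain ⟨C₀, hC₀⟩ := hfd.exists_lintegral_iteratedFDeriv_slice_sq_le
    (μ := (volume : Measure (EuclideanSpace ℝ (Fin 3)))) hfs 0 zero_le_one
  have hC₀' : ∀ t ∈ Icc (0 : ℝ) T, ∫⁻ x, ‖f t x‖ₑ ^ 2 ≤ (C₀ : ℝ≥0∞) := by
    intro t ht
    have h := hC₀ t ht.1
    have e : ∀ x, ‖iteratedFDeriv ℝ 0 (f t) x‖ₑ = ‖f t x‖ₑ := fun x => by
      rw [← ofReal_norm, ← ofReal_norm, norm_iteratedFDeriv_zero]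
    simpa only [e] using h
  -- the two universal kernel constants
  set K₁ : ℝ≥0∞ := ∫⁻ z, ‖(Metric.ball (0 : EuclideanSpace ℝ (Fin 3)) 1).indicator
    (fun z : EuclideanSpace ℝ (Fin 3) => (4 * Real.pi * ‖z‖ ^ 2)⁻¹) z‖ₑ with hK₁
  set K₂ : ℝ≥0∞ := eLpNorm ((Metric.ball (0 : EuclideanSpace ℝ (Fin 3)) 1)ᶜ.indicator
    fun z : EuclideanSpace ℝ (Fin 3) => (4 * Real.pi * ‖z‖ ^ 2)⁻¹) 2 volume with hK₂
  have hK₁t : K₁ < ⊤ := integrable_forceMajorant_near.2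
  have hK₂t : K₂ < ⊤ := memLp_forceMajorant_far.eLpNorm_lt_top
  set P : ℝ≥0∞ := K₁ * (C₀ : ℝ≥0∞) ^ (1 / 2 : ℝ) + N * K₂ with hP
  have hPt : P < ⊤ := ENNReal.add_lt_top.2
    ⟨ENNReal.mul_lt_top hK₁t (ENNReal.rpow_lt_top_of_nonneg (by norm_num) ENNReal.coe_ne_top),
      ENNReal.mul_lt_top hNt hK₂t⟩
  refine ⟨C₀, P ^ 2, ENNReal.coe_lt_top, ENNReal.pow_lt_top hPt, fun t ht => ⟨hC₀' t ht, ?_⟩⟩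
  obtain ⟨hsup, hint, hL1⟩ := hMN t ht
  have hcont : Continuous (f t) :=
    ((hfs.isSmoothSpaceTimeOn_Icc T).contDiff_slice ht).continuous
  refine ⟨aestronglyMeasurable_forcePotential hcont.measurable, ?_⟩
  have h2 : eLpNorm (f t) 2 volume ≤ (C₀ : ℝ≥0∞) ^ (1 / 2 : ℝ) := by
    rw [eLpNorm_two_eq_sqrt_lintegral']
    gcongr
    exact hC₀' t ht
  have hle : eLpNorm (forcePotential (f t)) 2 volume ≤ P :=
    (eLpNorm_forcePotential_le hcont hint hsup).trans (by rw [hP]; gcongr)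
  calc ∫⁻ x, ‖forcePotential (f t) x‖ₑ ^ 2
      = (eLpNorm (forcePotential (f t)) 2 volume) ^ 2 := by
        rw [eLpNorm_two_eq_sqrt_lintegral', ← ENNReal.rpow_natCast, ← ENNReal.rpow_mul]
        norm_num
    _ ≤ P ^ 2 := by gcongr

/-- **Lemma 8.1 WITH a Clay-class force: finite dissipation.** A classical solution of the forced
system (`ν > 0`) on `[0,T] × ℝ³`, `T > 0`, with finite energy and a Clay-class force has
`∫₀ᵀ∫|∇u|² < ∞` — the tree's forced energy equality
(`IsClassicalNSSolutionOn.energyEq_of_finiteEnergy_forced_ae_of_fact`, Tao §8 (61)–(65) WITH force)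
fed with the PROVED corrected pressure normalisation `tao2011_forced_pressure_normalisation_ae_holds`
and the slice bounds above. [cite: Tao2011, Lemma 8.1 (arXiv Lemma 44, p. 24) with Lemma 4.1 (i)] -/
theorem IsClassicalNSSolutionOn.dissipation_lt_top_of_clayForce {ν T : ℝ}
    {u : ℝ → EuclideanSpace ℝ (Fin 3) → EuclideanSpace ℝ (Fin 3)}
    {p : ℝ → EuclideanSpace ℝ (Fin 3) → ℝ} (hsol : FluidPDE.IsClassicalNSSolutionOn (Icc 0 T) ν f u p)
    (hν : 0 < ν) (hT : 0 < T) (hfs : IsSmoothOnHalfSpace f) (hfd : HasRapidSpaceTimeDecay f)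
    (hE : ∃ A : ℝ≥0∞, A < ⊤ ∧ ∀ t ∈ Icc 0 T, ∫⁻ x, ‖u t x‖ₑ ^ 2 ≤ A) :
    ∫⁻ t in Ioo 0 T, ∫⁻ x, ENNReal.ofReal (FluidPDE.frobeniusNormSq (fderiv ℝ (u t) x)) < ⊤ := by
  obtain ⟨Cf, Pf, hCft, hPft, hb⟩ := clayForce_slice_potential_bounds (T := T) hfs hfd
  obtain ⟨A, hAt, hA⟩ := hE
  exact (hsol.energyEq_of_finiteEnergy_forced_ae_of_fact tao2011_forced_pressure_normalisation_ae_holds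
    hν hT hCft.ne (fun t ht => (hb t ht).1) hPft.ne (fun t ht => (hb t ht).2.1)
    (fun t ht => (hb t ht).2.2) hAt.ne hA).1

/-- **Tao 2011, Cor. 11.4 WITH a Clay-class (Schwartz) force, velocity form — reduced to the finite
total speed of the two solutions.** In exactly the dictionary of the tree's specialisation
`tao2011_forced_unconditionalUniqueness_velocity.schwartzForce` (`ν > 0`, `0 < T`, datum
`u₀, ∇u₀ ∈ L²`, force smooth on `[0,∞) × ℝ³` with Fefferman's decay (5), two classical solutions of
the forced system on `[0,T] × ℝ³` from `u₀` with finite energy): IF both have finite total speed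
`∫₀ᵀ‖u‖_{L^∞} < ∞`, `∫₀ᵀ‖v‖_{L^∞} < ∞` (Prop. 9.1 WITH force — the one input of the printed chain
not yet in the tree), then `u = v` on `[0,T]`. Finite dissipation (Lemma 8.1 WITH force) is
discharged by `dissipation_lt_top_of_clayForce`. [cite: Tao2011, Cor. 11.4 (arXiv Cor. 71, p. 36) + Remark 11.3] -/
theorem tao2011_forced_unconditionalUniqueness_velocity_schwartzForce_of_totalSpeed
    {ν T : ℝ} (hν : 0 < ν) (hT : 0 < T)
    {u₀ : EuclideanSpace ℝ (Fin 3) → EuclideanSpace ℝ (Fin 3)}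
    (h₀ : MemLp u₀ 2 volume) (h₁ : MemLp (fderiv ℝ u₀) 2 volume)
    (hfs : IsSmoothOnHalfSpace f) (hfd : HasRapidSpaceTimeDecay f)
    {u v : ℝ → EuclideanSpace ℝ (Fin 3) → EuclideanSpace ℝ (Fin 3)}
    {p q : ℝ → EuclideanSpace ℝ (Fin 3) → ℝ}
    (hu : FluidPDE.IsClassicalNSSolutionOn (Icc 0 T) ν f u p)
    (hv : FluidPDE.IsClassicalNSSolutionOn (Icc 0 T) ν f v q)
    (hu0 : u 0 = u₀) (hv0 : v 0 = u₀)
    (hEu : ∃ C : ℝ≥0∞, C < ⊤ ∧ ∀ t ∈ Icc 0 T, ∫⁻ x, ‖u t x‖ₑ ^ 2 ≤ C)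
    (hEv : ∃ C : ℝ≥0∞, C < ⊤ ∧ ∀ t ∈ Icc 0 T, ∫⁻ x, ‖v t x‖ₑ ^ 2 ≤ C)
    (huM : ∫⁻ t in Ioo 0 T, eLpNorm (u t) ∞ volume < ⊤)
    (hvM : ∫⁻ t in Ioo 0 T, eLpNorm (v t) ∞ volume < ⊤) :
    ∀ t ∈ Icc 0 T, u t = v t := by
  -- the force: smooth on the slab, `L^∞_t H¹_x`
  have hf : FluidPDE.IsSmoothSpaceTimeOn (Icc 0 T) f := hfs.isSmoothSpaceTimeOn_Icc T
  have hfH1 : ∀ j ≤ 1, ∃ C : ℝ≥0, ∀ s ∈ Icc 0 T,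
      ∫⁻ x, ‖iteratedFDeriv ℝ j (f s) x‖ₑ ^ 2 ≤ C := by
    intro j hj
    obtain ⟨C, hC⟩ := hfd.exists_lintegral_iteratedFDeriv_slice_sq_le
      (μ := (volume : Measure (EuclideanSpace ℝ (Fin 3)))) hfs j hj
    exact ⟨C, fun s hs => hC s hs.1⟩
  -- the datum
  have hdat : ∀ j ≤ 1, ∫⁻ x, ‖iteratedFDeriv ℝ j (u 0) x‖ₑ ^ 2 < ⊤ := by
    rw [hu0]; exact lintegral_iteratedFDeriv_sq_lt_top_of_memLp h₀ h₁
  -- energies in `ℝ≥0` form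
  have hE : ∀ {w : ℝ → EuclideanSpace ℝ (Fin 3) → EuclideanSpace ℝ (Fin 3)},
      (∃ C : ℝ≥0∞, C < ⊤ ∧ ∀ s ∈ Icc 0 T, ∫⁻ x, ‖w s x‖ₑ ^ 2 ≤ C) →
      ∃ C : ℝ≥0, ∀ s ∈ Icc 0 T, ∫⁻ x, ‖w s x‖ₑ ^ 2 ≤ C := by
    rintro w ⟨C, hCtop, hC⟩
    exact ⟨C.toNNReal, fun s hs => (hC s hs).trans (ENNReal.coe_toNNReal hCtop.ne).ge⟩
  -- dissipation (Lemma 8.1 WITH force, Clay class)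
  have huD := hu.dissipation_lt_top_of_clayForce hν hT hfs hfd hEu
  have hvD := hv.dissipation_lt_top_of_clayForce hν hT hfs hfd hEv
  have hvu := tao2011_forced_unconditionalUniqueness_velocity_of_totalSpeed hν hT hf hfH1 hu hv hdat
    (hv0.trans hu0.symm) (hE hEu) (hE hEv) huD hvD huM hvM
  intro t ht
  exact (hvu t ht).symm

end ClayForce

end Literature.Analysis.FluidPDE

end
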